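import Summits.PneNP.PneNP.Theorems.SymmetryBudgetNoHiddenOrderCertifiedScheme

/-!
# Certified labels: the replay decoding map and its correctness along the solution subtree

Route `PneNP/SymmetryBudget`, item `NoHiddenOrder` (stmt-PneNP-14781); memo ANALYSIS-4 §2 (evidence on the
item).  `SymmetryBudgetNoHiddenOrderCertifiedScheme.lean` proves soundness of the certified label scheme for an
ARBITRARY decoding map and completeness under the hypothesis `hdec` that the labels of the solution subtree
decode correctly.  Here the decoding map of the memo is defined — REPLAY from the root, taking at a section
node the part containing the target vertex set and at an individualisation node the unique `λ`-maximal
already-named vertex of the cell — and `hdec` is DISCHARGED from the anti-layering condition (C1):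

* `replay P L J C` — the replay of label `L` from instance `J` with consumed set `C` (well-founded on the
  syntactic measure; guards make it total on every `Process`);
* `ReachFrom` — the head-step presentation of the solution subtree (`reach_iff_reachFrom_root`);
* `replay_correct` — if (C1′) "an individualisation node met below, whose selected vertex lies in my cell,
  carries a smaller value" holds along the solution subtree (this is `CertifiedLabels.PassOverPath.
  height_lt_of_passOver` for the heights), selected vertices are fresh, parts are vertex-disjoint,
  instances are nonempty and children keep the vertex set, then every label of the solution subtree
  replays to its own node;
* `val_complete_replay` — completeness of the scheme with the replay decoding, hypotheses (C1′) +
  freshness + admissibility + the three structural facts only.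

Mathlib + the scheme files only; supports stmt-PneNP-14781 (does not close it).
-/

-- `Summit.PneNP.PneNP.…` duplicates `PneNP` BY DESIGN (single-problem summit, D-0017 layout).
set_option linter.dupNamespace false

namespace Summit.PneNP.PneNP.Theorems

namespace CertifiedLabels

open Finset

variable {W : Type*} [DecidableEq W] (P : Process W)

/-! ### The replay map -/

open scoped Classical in
/-- REPLAY of the label `L` from the instance `J` with consumed set `C` (ANALYSIS-4 §2, DECODING): stop when
`(verts J, C) = (L.U, L.X)`; at a section node continue into a part containing `L.U`; at an
individualisation node with cell `A` let `S := A ∩ (L.X ∖ C)` and continue into the child of the unique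
`L.lam`-maximal element of `S`, consuming it; fail otherwise.  (The two guards `verts (ch x) = verts J`,
`x ∉ C` hold in every genuine process; they make the recursion well founded on every `Process`.) -/
noncomputable def replay [Fintype W] (L : Label W) : P.Inst → Finset W → Option P.Inst
  | J, C =>
    if P.verts J = L.U ∧ C = L.X then some J else
    match P.step J with
    | .leaf => none
    | .andNode ps =>
        if h : ∃ J' ∈ ps, L.U ⊆ P.verts J' ∧ P.verts J' ⊂ P.verts J then replay L h.choose C
        else none
    | .orNode A ch =>
        if h : ∃ x, (A.filter fun y => y ∈ L.X ∧ y ∉ C).filter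
            (fun y => ∀ z ∈ A.filter (fun y => y ∈ L.X ∧ y ∉ C), L.lam z ≤ L.lam y) = {x} then
          if _hg : P.verts (ch h.choose) = P.verts J ∧ h.choose ∉ C then
            replay L (ch h.choose) (insert h.choose C)
          else none
        else none
termination_by J C => (P.verts J).card * (Fintype.card W + 1) + (Fintype.card W - C.card)
decreasing_by
  · have h1 := card_lt_card h.choose_spec.2.2
    have h3 : ((P.verts h.choose).card + 1) * (Fintype.card W + 1) ≤ (P.verts J).card * (Fintype.card W + 1) :=
      Nat.mul_le_mul_right _ h1
    nlinarith
  · rw [_hg.1]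
    have h1 : (insert h.choose C).card = C.card + 1 := card_insert_of_notMem _hg.2
    have h2 : (insert h.choose C).card ≤ Fintype.card W := card_le_univ _
    omega

variable {P}

/-! ### Head-step presentation of the solution subtree -/

/-- `ReachFrom sel hv I X lam ν Xν λν`: the node `ν` with label data `(Xν, λν)` lies in the solution subtree
below the node `I` with label data `(X, lam)` (steps taken at the HEAD). -/
inductive ReachFrom (sel : P.Inst → W) (hv : P.Inst → ℕ) :
    P.Inst → Finset W → (W → ℕ) → P.Inst → Finset W → (W → ℕ) → Prop
  | refl {I : P.Inst} {X : Finset W} {lam : W → ℕ} : ReachFrom sel hv I X lam I X lam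
  | part {I : P.Inst} {X : Finset W} {lam : W → ℕ} {ps : Finset P.Inst} {J : P.Inst} {ν : P.Inst}
      {Xν : Finset W} {lamν : W → ℕ} :
      P.step I = .andNode ps → J ∈ ps → ReachFrom sel hv J X lam ν Xν lamν → ReachFrom sel hv I X lam ν Xν lamν
  | child {I : P.Inst} {X : Finset W} {lam : W → ℕ} {A : Finset W} {ch : W → P.Inst} {ν : P.Inst}
      {Xν : Finset W} {lamν : W → ℕ} :
      P.step I = .orNode A ch →
        ReachFrom sel hv (ch (sel I)) (insert (sel I) X) (Function.update lam (sel I) (hv I)) ν Xν lamν →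
        ReachFrom sel hv I X lam ν Xν lamν

variable {sel : P.Inst → W} {hv : P.Inst → ℕ} {I₀ : P.Inst}

/-- Appending a section step at the tail. -/
theorem ReachFrom.snoc_part {I : P.Inst} {X : Finset W} {lam : W → ℕ} {J : P.Inst} {XJ : Finset W}
    {lamJ : W → ℕ} (h : ReachFrom sel hv I X lam J XJ lamJ) {ps : Finset P.Inst} {K : P.Inst}
    (hs : P.step J = .andNode ps) (hK : K ∈ ps) : ReachFrom sel hv I X lam K XJ lamJ := by
  induction h with
  | refl => exact ReachFrom.part hs hK ReachFrom.refl
  | part hs' hJ' _ ih => exact ReachFrom.part hs' hJ' (ih hs)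
  | child hs' _ ih => exact ReachFrom.child hs' (ih hs)

/-- Appending an individualisation step at the tail. -/
theorem ReachFrom.snoc_child {I : P.Inst} {X : Finset W} {lam : W → ℕ} {J : P.Inst} {XJ : Finset W}
    {lamJ : W → ℕ} (h : ReachFrom sel hv I X lam J XJ lamJ) {A : Finset W} {ch : W → P.Inst}
    (hs : P.step J = .orNode A ch) :
    ReachFrom sel hv I X lam (ch (sel J)) (insert (sel J) XJ) (Function.update lamJ (sel J) (hv J)) := by
  induction h with
  | refl => exact ReachFrom.child hs ReachFrom.refl
  | part hs' hJ' _ ih => exact ReachFrom.part hs' hJ' (ih hs)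
  | child hs' _ ih => exact ReachFrom.child hs' (ih hs)

/-- The solution subtree from the root, head-step form. -/
theorem reachFrom_root_of_reach {I : P.Inst} {X : Finset W} {lam : W → ℕ} (h : Reach P sel hv I₀ I X lam) :
    ReachFrom sel hv I₀ ∅ (fun _ => 0) I X lam := by
  induction h with
  | root => exact ReachFrom.refl
  | part _ hs hJ ih => exact ih.snoc_part hs hJ
  | child _ hs ih => exact ih.snoc_child hs

/-- Nodes below a node of the solution subtree are in the solution subtree. -/
theorem ReachFrom.reach {I : P.Inst} {X : Finset W} {lam : W → ℕ} {ν : P.Inst} {Xν : Finset W}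
    {lamν : W → ℕ} (h : ReachFrom sel hv I X lam ν Xν lamν) (hI : Reach P sel hv I₀ I X lam) :
    Reach P sel hv I₀ ν Xν lamν := by
  induction h with
  | refl => exact hI
  | part hs hJ _ ih => exact ih (Reach.part hI hs hJ)
  | child hs _ ih => exact ih (Reach.child hI hs)

/-- Vertex sets only shrink along the solution subtree (children keep them, parts shrink them). -/
theorem ReachFrom.verts_subset {I : P.Inst} {X : Finset W} {lam : W → ℕ} {ν : P.Inst} {Xν : Finset W}
    {lamν : W → ℕ} (h : ReachFrom sel hv I X lam ν Xν lamν)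
    (hverts : ∀ I A ch, P.step I = .orNode A ch → P.verts (ch (sel I)) = P.verts I) :
    P.verts ν ⊆ P.verts I := by
  induction h with
  | refl => exact Subset.rfl
  | part hs hJ _ ih => exact ih.trans (P.parts_ssubset _ _ hs _ hJ).1
  | child hs _ ih => exact ih.trans (hverts _ _ _ hs).subset

/-- **Values along the solution subtree.**  Below the node `(I, X, lam)`: the named set grows (`X ⊆ Xν`), the
values of the already-named vertices are kept, and every newly named vertex is the selected vertex of an
individualisation node met on the way, with the value recorded there. -/
theorem ReachFrom.named {I : P.Inst} {X : Finset W} {lam : W → ℕ} {ν : P.Inst} {Xν : Finset W}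
    {lamν : W → ℕ} (h : ReachFrom sel hv I X lam ν Xν lamν) (hI : Reach P sel hv I₀ I X lam)
    (hfresh : ∀ I X lam A ch, Reach P sel hv I₀ I X lam → P.step I = .orNode A ch → sel I ∉ X) :
    X ⊆ Xν ∧ (∀ y ∈ X, lamν y = lam y) ∧
      ∀ y ∈ Xν, y ∉ X → ∃ (β : P.Inst) (Xβ : Finset W) (lamβ : W → ℕ) (A : Finset W) (ch : W → P.Inst),
        Reach P sel hv I₀ β Xβ lamβ ∧ ReachFrom sel hv I X lam β Xβ lamβ ∧ P.step β = .orNode A ch ∧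
          y = sel β ∧ lamν y = hv β := by
  induction h with
  | refl => exact ⟨Subset.rfl, fun _ _ => rfl, fun y hy hy' => absurd hy hy'⟩
  | @part I X lam ps J ν Xν lamν hs hJ _ ih =>
    obtain ⟨h1, h2, h3⟩ := ih (Reach.part hI hs hJ)
    refine ⟨h1, h2, fun y hy hy' => ?_⟩
    obtain ⟨β, Xβ, lamβ, A, ch, hR, hRF, hsβ, hy1, hy2⟩ := h3 y hy hy'
    exact ⟨β, Xβ, lamβ, A, ch, hR, ReachFrom.part hs hJ hRF, hsβ, hy1, hy2⟩
  | @child I X lam A ch ν Xν lamν hs _ ih =>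
    have hx : sel I ∉ X := hfresh I X lam A ch hI hs
    obtain ⟨h1, h2, h3⟩ := ih (Reach.child hI hs)
    refine ⟨fun y hy => h1 (mem_insert_of_mem hy), fun y hy => ?_, fun y hy hy' => ?_⟩
    · rw [h2 y (mem_insert_of_mem hy), Function.update_of_ne]
      rintro rfl; exact hx hy
    · by_cases hyx : y = sel I
      · subst hyx
        refine ⟨I, X, lam, A, ch, hI, ReachFrom.refl, hs, rfl, ?_⟩
        rw [h2 _ (mem_insert_self _ _), Function.update_self]
      · have hy'' : y ∉ insert (sel I) X := by simp [hyx, hy']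
        obtain ⟨β, Xβ, lamβ, A', ch', hR, hRF, hsβ, hy1, hy2⟩ := h3 y hy hy''
        exact ⟨β, Xβ, lamβ, A', ch', hR, ReachFrom.child hs hRF, hsβ, hy1, hy2⟩

/-! ### Correctness of the replay along the solution subtree -/

/-- **Replay correctness (the decoding lemma of ANALYSIS-4 §2).**  Hypotheses: a legal selector; selected
vertices are fresh on the solution subtree; parts of a section node are vertex-disjoint; instances are
nonempty; children keep the vertex set; and **(C1′)**: if `β` is an individualisation node below the
child of the individualisation node `I` on the solution subtree and `sel β ∈ A_I` (i.e. `I` passes over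
`β`), then `hv β < hv I`.  Conclusion: every label of the solution subtree below `(I, X, lam)` replays,
from `(I, X)`, to its own node. -/
theorem replay_correct [Fintype W]
    (hsel : ∀ I A ch, P.step I = .orNode A ch → sel I ∈ A)
    (hfresh : ∀ I X lam A ch, Reach P sel hv I₀ I X lam → P.step I = .orNode A ch → sel I ∉ X)
    (hdisj : ∀ I ps, P.step I = .andNode ps → ∀ J₁ ∈ ps, ∀ J₂ ∈ ps, J₁ ≠ J₂ → Disjoint (P.verts J₁) (P.verts J₂))
    (hne : ∀ I, (P.verts I).Nonempty)
    (hverts : ∀ I A ch, P.step I = .orNode A ch → P.verts (ch (sel I)) = P.verts I)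
    (hC1 : ∀ I X lam A ch, Reach P sel hv I₀ I X lam → P.step I = .orNode A ch →
      ∀ β Xβ lamβ Aβ chβ, ReachFrom sel hv (ch (sel I)) (insert (sel I) X) (Function.update lam (sel I) (hv I)) β Xβ lamβ →
        P.step β = .orNode Aβ chβ → sel β ∈ A → hv β < hv I)
    {I : P.Inst} {X : Finset W} {lam : W → ℕ} {ν : P.Inst} {Xν : Finset W} {lamν : W → ℕ}
    (h : ReachFrom sel hv I X lam ν Xν lamν) (hI : Reach P sel hv I₀ I X lam) :
    replay P ⟨P.verts ν, Xν, lamν⟩ I X = some ν := by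
  induction h with
  | refl => rw [replay]; simp
  | @part I X lam ps J ν Xν lamν hs hJ htail ih =>
    have hIJ : Reach P sel hv I₀ J X lam := Reach.part hI hs hJ
    have hsub : P.verts ν ⊆ P.verts J := htail.verts_subset hverts
    have hss : P.verts J ⊂ P.verts I := P.parts_ssubset I ps hs J hJ
    rw [replay]
    have hneq : ¬ (P.verts I = P.verts ν ∧ X = Xν) := fun h' =>
      (hss.trans_subset (h'.1 ▸ hsub)).ne rfl
    rw [if_neg hneq]
    simp only [hs]
    have hex : ∃ J' ∈ ps, P.verts ν ⊆ P.verts J' ∧ P.verts J' ⊂ P.verts I :=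
      ⟨J, hJ, hsub, hss⟩
    rw [dif_pos hex]
    -- the part containing `verts ν` is `J`
    have hJ' : hex.choose = J := by
      by_contra hne'
      have hd := hdisj I ps hs _ hex.choose_spec.1 J hJ hne'
      obtain ⟨w, hw⟩ := hne ν
      exact disjoint_left.1 hd (hex.choose_spec.2.1 hw) (hsub hw)
    rw [hJ']
    exact ih hIJ
  | @child I X lam A ch ν Xν lamν hs htail ih =>
    have hx : sel I ∉ X := hfresh I X lam A ch hI hs
    have hIc : Reach P sel hv I₀ (ch (sel I)) (insert (sel I) X) (Function.update lam (sel I) (hv I)) :=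
      Reach.child hI hs
    obtain ⟨h1, h2, h3⟩ := htail.named hIc hfresh
    have hxX : sel I ∈ Xν := h1 (mem_insert_self _ _)
    have hlamx : lamν (sel I) = hv I := by rw [h2 _ (mem_insert_self _ _), Function.update_self]
    rw [replay]
    have hneq : ¬ (P.verts I = P.verts ν ∧ X = Xν) := fun h' => hx (h'.2 ▸ hxX)
    rw [if_neg hneq]
    simp only [hs]
    -- the competitor set and its unique maximum
    set S : Finset W := A.filter fun y => y ∈ Xν ∧ y ∉ X with hSdef
    have hxS : sel I ∈ S := mem_filter.2 ⟨hsel I A ch hs, hxX, hx⟩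
    have hlt : ∀ z ∈ S, z ≠ sel I → lamν z < lamν (sel I) := by
      intro z hz hzx
      obtain ⟨hzA, hzX, hzX'⟩ := mem_filter.1 hz
      have hz' : z ∉ insert (sel I) X := by simp [hzx, hzX']
      obtain ⟨β, Xβ, lamβ, Aβ, chβ, -, hRF, hsβ, hz1, hz2⟩ := h3 z hzX hz'
      rw [hz2, hlamx]
      exact hC1 I X lam A ch hI hs β Xβ lamβ Aβ chβ hRF hsβ (hz1 ▸ hzA)
    have hM : S.filter (fun y => ∀ z ∈ S, lamν z ≤ lamν y) = {sel I} := by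
      ext y
      simp only [mem_filter, mem_singleton]
      constructor
      · rintro ⟨hy, hmax⟩
        by_contra hyx
        exact absurd (hmax _ hxS) (not_le.2 (hlt y hy hyx))
      · rintro rfl
        refine ⟨hxS, fun z hz => ?_⟩
        by_cases hzx : z = sel I
        · rw [hzx]
        · exact (hlt z hz hzx).le
    have hex : ∃ x, S.filter (fun y => ∀ z ∈ S, lamν z ≤ lamν y) = {x} := ⟨sel I, hM⟩
    rw [dif_pos hex]
    have hchoose : hex.choose = sel I := by
      have hss' : ({sel I} : Finset W) = {hex.choose} := hM.symm.trans hex.choose_spec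
      exact (singleton_injective hss').symm
    have hg : P.verts (ch hex.choose) = P.verts I ∧ hex.choose ∉ X := by
      rw [hchoose]; exact ⟨hverts I A ch hs, hx⟩
    rw [dif_pos hg]
    simp only [hchoose]
    exact ih hIc

/-- **Completeness of the certified label scheme with the replay decoding.**  `val_complete` with its
decoding hypothesis discharged: along the solution subtree of a legal selector with values `< g`
satisfying (C1′), with fresh selections, admissible labels, vertex-disjoint parts, nonempty instances and
children keeping the vertex set, every group of the solution subtree outputs a value. -/
theorem val_complete_replay [Fintype W] {Val : Type*} [DecidableEq Val] (V : Valuation P Val)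
    (adm : Label W → Prop) (g : ℕ) (sel : P.Inst → W) (hv : P.Inst → ℕ) (I₀ : P.Inst)
    (hsel : ∀ I A ch, P.step I = .orNode A ch → sel I ∈ A)
    (hvg : ∀ I A ch, P.step I = .orNode A ch → hv I < g)
    (hverts : ∀ I A ch, P.step I = .orNode A ch → P.verts (ch (sel I)) = P.verts I)
    (hfresh : ∀ I X lam A ch, Reach P sel hv I₀ I X lam → P.step I = .orNode A ch → sel I ∉ X)
    (hadm : ∀ I X lam, Reach P sel hv I₀ I X lam → adm ⟨P.verts I, X, lam⟩)
    (hdisj : ∀ I ps, P.step I = .andNode ps → ∀ J₁ ∈ ps, ∀ J₂ ∈ ps, J₁ ≠ J₂ → Disjoint (P.verts J₁) (P.verts J₂))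
    (hne : ∀ I, (P.verts I).Nonempty)
    (hC1 : ∀ I X lam A ch, Reach P sel hv I₀ I X lam → P.step I = .orNode A ch →
      ∀ β Xβ lamβ Aβ chβ, ReachFrom sel hv (ch (sel I)) (insert (sel I) X) (Function.update lam (sel I) (hv I)) β Xβ lamβ →
        P.step β = .orNode Aβ chβ → sel β ∈ A → hv β < hv I) :
    ∀ I X lam, Reach P sel hv I₀ I X lam →
      val P V (fun L => replay P L I₀ ∅) adm g ⟨P.verts I, X, lam⟩ ≠ none := by
  refine val_complete P V _ adm g sel hv I₀ hsel hvg hverts (fun I X lam hR => ?_) hfresh hadm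
  exact replay_correct hsel hfresh hdisj hne hverts hC1 (reachFrom_root_of_reach hR) Reach.root

end CertifiedLabels

end Summit.PneNP.PneNP.Theorems
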